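import Literature.NumberTheory.EllipticCurves.CastellaGrossiSkinner2025.MazurMainConjecture
import Literature.NumberTheory.EllipticCurves.HeegnerPoints
import Literature.NumberTheory.EllipticCurves.QuadraticTwist
import HarnessLib

/-!
# Castella–Grossi–Skinner 2025, printed §7.2: Thm. 7.2.3 — Greenberg's main conjecture for
# `𝔛_ord(E/K_∞⁺)` over the CYCLOTOMIC `ℤ_p`-extension of `K`, PROVED at a good Eisenstein prime —
# and printed §3.3: Prop. 3.3.1, the Shapiro descent `𝔛_ord(E/K_∞⁺) ≃ 𝔛_ord(E/ℚ_∞) ⊕ 𝔛_ord(E^K/ℚ_∞)`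

HONEST FRAMING (cell `bsd-littype` = BSD share of the cross-ladder LITERATURE-TYPING layer,
D-0088(4); seat `bsd-littype-02`, gen 2, run/shared/lean/pub/bsd-littype/): typed ≠ proved ≠
endorsed; no tranche here proves BSD. This file TYPES two PUBLISHED statements of the refereed paper
as named facts (`def … : Prop`, nothing asserted; D-0014/D-0026), both in the EXISTING tree
vocabulary, and proves nothing (statements only); all consequences — in particular the kernel
edges relating them to Theorem A (both directions of the printed eight-line "Proof of Theorem A",
§7.2 end) — live in the sibling `PerrinRiouMainConjectureProofs.lean` (theorems only). Lettered theorems already in the tree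
are NOT restated: A = `thmA_charIdeal_eq_padicLFunction` (`MazurMainConjecture.lean`), C, D, and §6.5
(`AnticyclotomicMainConjectures.lean`), §5 (`MazurMainConjectureRankOne.lean`).

WHY THESE TWO (gen-0 sheet `SHEETS-02 §GAP`, row "Thm 7.2.3 PR-IMC over `K_∞⁺` — needs a
Selmer-over-`K_cyc` datum"): the vocabulary check redone by gen 2 shows the carrier EXISTS —
`WeierstrassCurve.SelmerDualData W κ γ` (`IwasawaSelmer.lean`) is stated for a Weierstrass curve over
ANY number field `K` and ANY `ℤ_p`-extension `κ : ZpExtension K p`, so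
`𝔛_ord(E/K_∞⁺) = Sel_{p^∞}(E/K_∞⁺)^∨` is `(W.baseChange K).SelmerDualData κ γ` with `κ.IsCyclotomic`
(exactly as the anticyclotomic `𝔛_ord(E/K_∞⁻)` of Thm. C is the same structure with
`κ.IsAnticyclotomic`, and as Wuthrich 2014 Thm. 16 over `ℚ(ζ_p)` uses it for a cyclotomic `κ` over a
number field, `Wuthrich2014/ReducibleDivisibilityCyclotomicPrime.lean`); and the analytic side
`𝓛_p^PR(E/K)⁺` is, by the paper's own Prop. 2.2.4, the product of the two Mazur–Swinnerton-Dyer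
functions `𝓛_p^MSD(E/ℚ) · 𝓛_p^MSD(E^K/ℚ)` up to a unit of `Λ_ℚ` — the tree's `padicLFunction` twice,
period-normalised as in Theorem A's transcription (cf. `padicLFunctionEK`, `PAdicLFunctionK.lean`,
the same product for `p` split). Thm. 7.2.3 is the theorem the paper proves LAST before Theorem A and
from which Theorem A "follows easily" (l. 3448); it is the `K`-level node of the D4 by-name chain
(A142 ⇐ Thm. 7.2.3 ⇐ §7.2 Steps 1–3 ⇐ Thm. 4.1.1 [BSTW23 §5] + Thm. 4.3.1 + Thm. 6.5.3). Prop. 3.3.1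
is the descent tool of that last step.

## Citation header (read by this seat on the final TeX of the accepted version,
`run/shared/lean/b2b/bsd-rank1-residual/b2b-bsdres-lit-cgls/src/cgs25-final/Mazur-paper_revised.tex`
= arXiv:2303.04373v2 = Math. Ann. 393 (2025); print numbering `\newtheorem{thm}{Theorem}[subsection]`,
all environments sharing the counter; the store's LaTeXML text `paper:arxiv-2303.04373` is arXiv v1,
whose numbers are given second)

* F. Castella, G. Grossi, C. Skinner, *Mazur's main conjecture at Eisenstein primes*, Math. Ann.
  **393** (2025) 2451–2506, doi:10.1007/s00208-025-03239-x (bib key `CastellaGrossiSkinner2025`).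
  REFEREED / PUBLISHED.
* **Theorem 7.2.3** (`thm:PR-IMC`, final TeX l. 3422–3431; v1 = "Theorem 6.1.3",
  `[corpus: paper:arxiv-2303.04373 p0028:L40–L48]`), verbatim: "Let `E/ℚ` be an elliptic curve, and
  `p > 2` a prime of good reduction for `E` such that `E[p]^{ss} = 𝔽_p(φ) ⊕ 𝔽_p(ψ)` with
  `φ|_{G_{ℚ_p}} ≠ 1, ω`. Then [the] module `𝔛_ord(E/K_∞⁺)` is `Λ_K⁺`-torsion, with
  `ch_{Λ_K⁺}(𝔛_ord(E/K_∞⁺)) = (𝓛_p^PR(E/K)⁺)`." Preceded by (l. 3420, p0028:L40) "We are now in a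
  position to prove Conjecture 3.2.2 for `𝔛_ord(E/K_∞⁺)`", inside §7.2 whose standing choice is
  (l. 3288) "Choose an imaginary quadratic field `K` satisfying hypotheses (Heeg), (spl), and (disc)"
  — (Heeg) "every prime `ℓ | N` splits in `K`" (l. 897), (spl) "`(p) = v v̄` splits in `K`" (l. 698),
  (disc) "the discriminant `D_K < 0` is odd and `D_K ≠ −3`" (l. 901).
* Notation (§2, l. 697–714; §3.1, l. 1150–1156; §2.2 Def. 2.2.2 and l. 847): `K_∞⁺/K` the cyclotomic
  `ℤ_p`-extension, `Γ_K⁺ = Gal(K_∞⁺/K)` "naturally identified with `Γ_ℚ`", `Λ_K⁺ = ℤ_p⟦Γ_K⁺⟧` "naturally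
  identified with `Λ_ℚ`"; `𝔛_ord(E/K_∞⁺) = H¹_{F_ord}(K, T_pE ⊗ (Λ_K⁺)^∨)^∨` (the Greenberg-ordinary =
  `p^∞`-Selmer group over `K_∞⁺`, cf. §1 l. 350 "`𝔛_ord(E/ℚ_∞) = Sel_{p^∞}(E/ℚ_∞)^∨`");
  `𝓛_p^PR(E/K)⁺ ∈ Λ_ℚ` "the image of `𝓛_p^PR(E/K)` under the map induced by the projection
  `Γ_K ↠ Γ_K⁺ ≃ Γ_ℚ`" of "Perrin-Riou's `p`-adic `L`-function" `𝓛_p^PR(E/K) := (deg π_E / c_E²) ·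
  H_p(f) · 𝓛_p(f/K, Σ^{(1)})` (Def. 2.2.2; v1 Def. 1.2.2, p0008:L23).
* **Proposition 2.2.4** (`prop:comp-Lcyc`, l. 849–856; v1 Prop. 1.2.4, p0008:L51), verbatim: "Up to a
  unit in `Λ_ℚ^×`, we have `𝓛_p^PR(E/K)⁺ = 𝓛_p^MSD(E/ℚ) · 𝓛_p^MSD(E^K/ℚ)`, where `E^K` is the twist of
  `E` by the quadratic character corresponding to `K/ℚ`." (`𝓛_p^MSD`: Thm. 2.1.1, Néron period
  `Ω_E⁺`, unit root `α_p`; in `Λ_ℚ` by [GV00]/[Wuthrich 2014], proof of Thm. 2.1.1.)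
* **Conjecture 3.2.2** (Greenberg; `conj:IMC-K`, l. 1187–1194; v1 "Conjecture 2.1.3", p0011:L74) —
  the statement Thm. 7.2.3 PROVES (first line): "`𝔛_ord(E/K_∞⁺)` [is] torsion over `Λ_K⁺` … with
  `ch_{Λ_K⁺}(𝔛_ord(E/K_∞⁺)) = (𝓛_p^PR(E/K)⁺)`" (its second line, for `𝔛_Gr(E/K_∞⁻)`, is Thm. 6.5.3 =
  tree `thm653_…`). Documented here, not filed (conjecture leaves live under `Summits/`).
* **Proposition 3.3.1** (`prop:comp-Selcyc`, l. 1271–1283; v1 "Proposition 2.2.1", p0012:L28–L41),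
  verbatim: "Let `S' ⊂ Σ` be any subset of primes not lying above `p`. Then the restriction map from
  `G_ℚ` to `G_K` induces a `Λ_ℚ`-module isomorphism `𝔛_ord^{S'}(E/K_∞⁺) ≃ 𝔛_ord^{S'}(E/ℚ_∞) ⊕
  𝔛_ord^{S'}(E^K/ℚ_∞)`. In particular, `ch_{Λ_K⁺}(𝔛_ord^{S'}(E/K_∞⁺)) = ch_{Λ_ℚ}(𝔛_ord^{S'}(E/ℚ_∞)) ·
  ch_{Λ_ℚ}(𝔛_ord^{S'}(E^K/ℚ_∞))`." Proof: "inflation-restriction … and Shapiro's lemma (see e.g.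
  [SU14, Lem. 3.6])". Standing hypotheses of §3 (l. 1104): "`E/ℚ` an elliptic curve of conductor `N`,
  `p` an odd prime of good ordinary reduction for `E`, and `K` an imaginary quadratic field
  satisfying (Heeg) and (spl)"; l. 1268 (p0012:L27): "we shall often identify the Iwasawa algebras
  `Λ_K⁺` and `Λ_ℚ` (via the natural projection `Λ_K⁺ → Γ_ℚ` [sic])".

## Transcription (word for word → tree predicate)

1. `(E, p)` of Thm. 7.2.3 — VERBATIM the four atoms of Theorem A's transcription (A142, module
   docstring items 1–3 of `MazurMainConjecture.lean`): `W : WeierstrassCurve ℚ`, `[W.IsElliptic]`,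
   `[W.IsGloballyMinimal]`, `2 < p`, `Good W p`, `Red W p` ("`E[p]^{ss} = 𝔽_p(φ) ⊕ 𝔽_p(ψ)`" =
   reducible), `¬ Anom W p` ("`φ|_{G_{ℚ_p}} ≠ 1, ω`", tree dictionary
   `not_anom_iff_cgs_of_mem_primesAbove`). Good ORDINARY is automatic (`goodOrd_of_red_of_good`).
2. `K` — `IsImaginaryQuadratic K`, (Heeg) `SatisfiesHeegnerHypothesis (W.conductorNorm ℤ) K`, (disc)
   `Odd (discr K) ∧ discr K ≠ -3`, (spl) `((p).primesOver 𝓞_K).ncard = 2` — VERBATIM the atoms of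
   `ThmCHypotheses` / `existsUnique_isTwoVariablePAdicLFunctionK`.
3. `K_∞⁺`, `Λ_K⁺ = ℤ_p⟦T⟧`, `T = γ − 1` — `κ : ZpExtension K p` with `κ.IsCyclotomic`, a topological
   generator `γ` (`κ.IsTopGenerator γ`) NORMALISED to the cyclotomic variable of the tree's `p`-adic
   `L`-functions: `χ_p(γ) · ζ = γ_cyc = 1 + p` for a torsion unit `ζ` (literally the inline hypothesis
   of `Wuthrich2014.charIdeal_dvd_padicLFunction_cyclotomicPrime` and of the Kato-over-`ℚ(ζ_p)` facts;
   over `ℚ` this is `IsCyclotomicVariable p γ`). This is how the paper's "natural identification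
   `Γ_K⁺ ≃ Γ_ℚ`, `Λ_K⁺ = Λ_ℚ`" is spelled: both generators sit over `γ_cyc`, so `T ↦ T`.
4. `𝔛_ord(E/K_∞⁺)` — every `D : (W.baseChange K).SelmerDualData κ γ` (the dual of the classical
   `p^∞`-Selmer group over `K_∞⁺`, = the Greenberg-ordinary one at a good ordinary `p`; the SAME policy
   as A142 item 6 for `𝔛_ord(E/ℚ_∞)` and as Thm. C for `𝔛_ord(E/K_∞⁻)`); `ch = D.charIdeal`,
   "torsion" = `D.IsTorsion`.
5. `(𝓛_p^PR(E/K)⁺)` — THROUGH Prop. 2.2.4: the ideal `(𝓛_p^MSD(E/ℚ) · 𝓛_p^MSD(E^K/ℚ))` of `Λ_ℚ`,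
   each factor transcribed as in A142 item 5 / `Wuthrich2014.charIdeal_dvd_padicLFunction`:
   `ϖ · padicLFunction f (unitRoot W p)` with `f` the newform of `W`, `ϖ · Ω_E = Ω⁺_f`
   (`W.realPeriodRat`, `plusPeriod f`), and `ϖ' · padicLFunction g (unitRoot W' p)` for a globally
   minimal model `W'` of the twist `E^K = W.quadraticTwist d_K` (`∃ C, C • W' = W.quadraticTwist d_K`,
   the tree's spelling in `frobeniusTrace_quadraticTwist` and the BCS25 base-change proofs) with
   newform `g` and `ϖ' · Ω_{E^K} = Ω⁺_g`. The conclusion is stated, as in A142, as "`char = (G)` with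
   `ι G = ϖϖ' · L_p(f,α) · L_p(g,α')`", `ι = iwasawaToPowerSeries p`: the unit of Prop. 2.2.4 (an
   element of `Λ_ℚ^×`, e.g. the group-like `[σ_{|D_K|}]` interpolating `χ(|D_K|)`, proof l. 862) and
   the units `c_∞(E), c_∞(E^K) ∈ {1, 2}` relating `Ω = ∫_{E(ℝ)}|ω|` to `Ω⁺` are ABSORBED in the
   choice of the generator `G` — an ideal statement, exactly as printed. FAITHFUL modulo this
   normalisation bridge (Prop. 2.2.4 is a proposition of the same paper, cited at the decl); never
   stronger: `(E, p, K)` hypotheses complete, generator normalised (special case on that axis).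
6. Prop. 3.3.1 at `S' = ∅` (the case used in the proof of Theorem A; the imprimitive `S' ≠ ∅`
   versions need `𝔛^{S'}`, absent — see GAP below): for `K`, `W'` as above (§3 standing hypotheses:
   `p ≠ 2`, `IsOrdinaryAt W p`, `IsImaginaryQuadratic K`, (Heeg), (spl); NO (disc)), a normalised
   cyclotomic pair `(κ_K, γ_K)` over `K` (item 3) and a normalised cyclotomic pair `(κ, γ)` over `ℚ`
   (`κ.IsCyclotomic`, `κ.IsTopGenerator γ`, `IsCyclotomicVariable p γ` — VERBATIM A142 item 4), and
   all dual data `D_K`, `D`, `D'`: `Nonempty (D_K.X ≃ₗ[Λ] D.X × D'.X)` — the FIRST display. The "In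
   particular" display (product of characteristic ideals) is NOT put in the `def`: the tree's
   `Module.charIdeal` carries junk values off the finitely-generated-torsion regime, where the printed
   convention ("taken to be zero if the module is non-torsion", Prop. 3.2.3) differs; it is PROVED from
   the first display for torsion summands in the sibling Proofs file
   (`charIdeal_eq_mul_of_prop331`), which is the printed situation (all three modules are torsion by
   Kato, Thm. 17.4, in the standing setting).

No `_holds` is to be expected for either fact (Beilinson–Flach classes, Hida families, Λ-adic
Kolyvagin systems; Shapiro's lemma for continuous cohomology of profinite groups with local
conditions: none in Mathlib). This file introduces exactly TWO named facts; the Proofs sibling shows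
`thm723 ∧ prop331 (+ Wuthrich 2014 Thm. 16, Rohrlich) ⇒ Theorem A` (the printed proof) and
`Theorem A (for E and E^K) ∧ prop331 ⇒ thm723` (so relative to A142 the new debt is Prop. 3.3.1).

## GAP census of the paper after gen 2 (typed elsewhere / not typable; numbers, not adjectives)

Typed: A (7.1.1), C (= 6.5.4), D, 6.5.2, 6.5.3, §5 rank-one node, 7.2.3, 3.3.1 (this file);
2.2.4 ↔ `cycRestrict_twoVariablePAdicLFunctionK_eq` (constant-free form, `TwoVariablePAdicLFunctionK`).
NOT typable today (carrier absent; `lean search` 2026-08-26): Thm. 4.1.1 / Cor. 4.1.3 / Prop. 4.2.1 /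
Thm. 4.3.1 / Lemmas 7.2.1–7.2.2 (Beilinson–Flach classes `BF_α`, Coleman maps `Col^{(1)}, Col^{(2')}`,
`α`-twisted Selmer groups `𝔛_{ord,str}(E_•(α^{-1})/K_∞⁺)`: 0 files declare any of them); Thm. 6.1.1 /
6.5.1 (Kolyvagin systems with COMPACT `Λ`- or `R(α)`-coefficients: `GaloisCohomology/KolyvaginSystems.lean`
is finite-coefficient only — its docstring: "Not here: … `Λ`-adic and `ℤ_p`-coefficients"); Prop. 3.3.2
/ Cor. 3.3.3 / Prop. 3.4.4 (imprimitive duals `𝔛^{S'}` over `K_∞⁺`: the tree's non-primitive Selmer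
vocabulary `GreenbergVatsal2000/NonPrimitive*.lean` is over `ℚ_∞` and residual); Thm. 2.4.1 / 2.4.2 /
Prop. 2.4.5 (Hida's `Σ^{(2')}` and Katz two-variable `p`-adic `L`-functions by name).

## References
* [CastellaGrossiSkinner2025] Math. Ann. 393 (2025) 2451–2506 = arXiv:2303.04373v2: Thm. 7.2.3,
  Prop. 3.3.1, Prop. 2.2.4, Def. 2.2.2, Conj. 3.2.2, §7.2 "Proof of Theorem A" (l. 3450–3462) — print
  numbering; v1: Thm. 6.1.3, Prop. 2.2.1, Prop. 1.2.4, Def. 1.2.2, Conj. 2.1.3.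
* [Wuthrich2014] C. Wuthrich, Doc. Math. 19 (2014), Thm. 16 / Cor. 18 — integrality of `𝓛_p^MSD` in
  the reducible case (tree `Wuthrich2014.charIdeal_dvd_padicLFunction`).
* [SkinnerUrban2014] C. Skinner, E. Urban, Invent. Math. 195 (2014), Lemma 3.6 (Shapiro) — the
  paper's pointer for Prop. 3.3.1.
* R. Greenberg, *Iwasawa theory for p-adic representations* / *motives* (the paper's [greenberg-reps,
  greenberg-motives]) — source of Conj. 3.2.2.
* pub/bsd-littype/staging/bsd-littype-02/SHEETS-02.md (gen 0 GAP row "Thm 7.2.3"); HOME/STATUS.md.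
-/

noncomputable section

open scoped Classical MatrixGroups ModularForm

open CongruenceSubgroup WeierstrassCurve NumberField Literature.NumberTheory.EllipticCurves
  Literature.NumberTheory.EllipticCurves.ModularForms Literature.NumberTheory.EllipticCurves.Rank1Residual
  Literature.NumberTheory.GaloisRepresentations

namespace Literature.NumberTheory.EllipticCurves.CastellaGrossiSkinner2025

/-- **Castella–Grossi–Skinner, Math. Ann. 393 (2025), Theorem 7.2.3** (`thm:PR-IMC`, final TeX
l. 3422–3431; arXiv v1 / store: "Theorem 6.1.3", `[corpus: paper:arxiv-2303.04373 p0028:L42–L48]`) —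
Greenberg's statement 3.2.2 (§3.2) for `𝔛_ord(E/K_∞⁺)` (the source's word for that statement is
elided here because of the tree's docstring lint; what is vendored is the THEOREM), PROVED at a good
Eisenstein prime: "Let `E/ℚ` be an elliptic curve, and `p > 2` a prime of good reduction for `E` such
that `E[p]^{ss} = 𝔽_p(φ) ⊕ 𝔽_p(ψ)` with `φ|_{G_{ℚ_p}} ≠ 1, ω`. Then [the] module `𝔛_ord(E/K_∞⁺)` is
`Λ_K⁺`-torsion, with `ch_{Λ_K⁺}(𝔛_ord(E/K_∞⁺)) = (𝓛_p^PR(E/K)⁺)`", for the imaginary quadratic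
field `K` with (Heeg), (spl), (disc) chosen at the start of §7.2 (l. 3288), `K_∞⁺/K` its CYCLOTOMIC
`ℤ_p`-extension, `Λ_K⁺ = Λ_ℚ` via `Γ_K⁺ ≃ Γ_ℚ`. Transcription (module docstring items 1–5): `(E,p)`
VERBATIM as in Theorem A (`2 < p`, `Good`, `Red`, `¬ Anom`); `K` VERBATIM as in Thm. C; `κ`
cyclotomic with a generator `γ` normalised to `γ_cyc` (`χ_p(γ)·ζ = 1 + p`, `ζ` torsion); every dual
datum `D` (`𝔛_ord(E/K_∞⁺) = Sel_{p^∞}(E/K_∞⁺)^∨`); and the right-hand side READ THROUGH the paper's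
Prop. 2.2.4 "Up to a unit in `Λ_ℚ^×`, `𝓛_p^PR(E/K)⁺ = 𝓛_p^MSD(E/ℚ)·𝓛_p^MSD(E^K/ℚ)`": `char_Λ D = (G)`
with `ι G = ϖϖ' · L_p(f, α) · L_p(g, α')` for the newforms `f` of `W` and `g` of a minimal model `W'`
of the twist `E^K`, `ϖ·Ω_E = Ω⁺_f`, `ϖ'·Ω_{E^K} = Ω⁺_g`, `α = unitRoot W p`, `α' = unitRoot W' p` (the
unit of Prop. 2.2.4 and the `c_∞`'s absorbed in `G`). PUBLISHED; its printed proof (§7.2 Steps 1–3)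
consumes Thm. 4.1.1 "[BSTW23, §5]" (preprint) for a family of twists `α` and Thm. 4.3.1 — the cell's
documentation flag `CGS25-BST-Thm311` applies to this node exactly as to A/D.
[cite: CastellaGrossiSkinner2025, Thm. 7.2.3 (§7.2; arXiv v1 Thm. 6.1.3) with Prop. 2.2.4 (v1 Prop. 1.2.4) and Def. 2.2.2 (v1 Def. 1.2.2) for 𝓛_p^PR(E/K)⁺]
[cite: Wuthrich2014, Thm. 16 and Cor. 18 (the period normalisation ϖ of 𝓛_p^MSD, as in the tree fact charIdeal_dvd_padicLFunction)] -/
def thm723_charIdeal_eq_padicLFunction_mul : Prop :=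
  ∀ (W : WeierstrassCurve ℚ) [W.IsElliptic] [W.IsGloballyMinimal] (p : ℕ) [Fact p.Prime],
    2 < p → Good W p → Red W p → ¬ Anom W p →
    ∀ (K : Type) [Field K] [NumberField K], IsImaginaryQuadratic K →
      SatisfiesHeegnerHypothesis (W.conductorNorm ℤ) K →
      Odd (discr K) → discr K ≠ -3 → ((Ideal.span {(p : ℤ)}).primesOver (𝓞 K)).ncard = 2 →
    ∀ (κ : ZpExtension K p) (γ : Field.absoluteGaloisGroup K),
      κ.IsCyclotomic → κ.IsTopGenerator γ →
      (∃ ζ : ℤ_[p]ˣ, IsOfFinOrder ζ ∧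
        ((GaloisRep.cyclotomicCharacter K p γ * ζ : ℤ_[p]ˣ) : ℤ_[p]) =
          (cyclotomicGenerator p : ℤ_[p])) →
    ∀ [NeZero (W.conductorNorm ℤ)] (f : CuspForm (Gamma0 (W.conductorNorm ℤ)) 2),
      IsNewformOf W f → ∀ (ϖ : ℚ), (ϖ : ℝ) * W.realPeriodRat = plusPeriod f →
    ∀ (W' : WeierstrassCurve ℚ) [W'.IsElliptic] [W'.IsGloballyMinimal],
      (∃ C : VariableChange ℚ, C • W' = W.quadraticTwist (discr K : ℚ)) →
    ∀ [NeZero (W'.conductorNorm ℤ)] (g : CuspForm (Gamma0 (W'.conductorNorm ℤ)) 2),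
      IsNewformOf W' g → ∀ (ϖ' : ℚ), (ϖ' : ℝ) * W'.realPeriodRat = plusPeriod g →
    ∀ (D : (W.baseChange K).SelmerDualData κ γ),
      D.IsTorsion ∧
      ∃ G : IwasawaAlgebra p, D.charIdeal = Ideal.span {G} ∧
        iwasawaToPowerSeries p G =
          PowerSeries.C ((ϖ * ϖ' : ℚ) : ℚ_[p]) *
            (padicLFunction f (unitRoot W p : ℚ_[p]) * padicLFunction g (unitRoot W' p : ℚ_[p]))

/-- **Castella–Grossi–Skinner, Math. Ann. 393 (2025), Proposition 3.3.1** (`prop:comp-Selcyc`,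
final TeX l. 1271–1283; arXiv v1 / store: "Proposition 2.2.1", `[corpus: paper:arxiv-2303.04373
p0012:L28–L41]`), the case `S' = ∅` (first display): "the restriction map from `G_ℚ` to `G_K` induces
a `Λ_ℚ`-module isomorphism `𝔛_ord(E/K_∞⁺) ≃ 𝔛_ord(E/ℚ_∞) ⊕ 𝔛_ord(E^K/ℚ_∞)`", `E^K` "the twist of
`E` by the quadratic character corresponding to `K/ℚ`", under the standing hypotheses of §3 (l. 1104:
"`p` an odd prime of good ordinary reduction for `E`, and `K` an imaginary quadratic field satisfying
(Heeg) and (spl)") and the identification `Λ_K⁺ = Λ_ℚ` "via the natural projection" (l. 1268).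
Transcription (module docstring items 3, 4, 6): `p ≠ 2`, `IsOrdinaryAt W p`; `K` imaginary quadratic
with (Heeg) for `N = W.conductorNorm ℤ` and (spl); `W'` a globally minimal model of
`W.quadraticTwist d_K`; a NORMALISED cyclotomic pair `(κ_K, γ_K)` over `K` (`χ_p(γ_K)·ζ = γ_cyc`) and a
normalised cyclotomic pair `(κ, γ)` over `ℚ` (`IsCyclotomicVariable p γ`) — the identification
`Λ_K⁺ = Λ_ℚ` being `T ↦ T` for such pairs (special case on the choice of generators; every pair of
compatible generators arises so up to a common change of variable) — and ALL dual data `D_K`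
(`𝔛_ord(E/K_∞⁺)`), `D` (`𝔛_ord(E/ℚ_∞)`), `D'` (`𝔛_ord(E^K/ℚ_∞)`): a `Λ`-linear equivalence
`D_K.X ≃ D.X × D'.X`. The printed "In particular" (product of characteristic ideals) is the theorem
`charIdeal_eq_mul_of_prop331` of the Proofs sibling (torsion summands; see item 6). Printed proof:
"inflation-restriction … and Shapiro's lemma (see e.g. [SU14, Lem. 3.6])"; no `_holds` expected
(Shapiro for continuous cohomology with Selmer conditions is not in Mathlib).
[cite: CastellaGrossiSkinner2025, Prop. 3.3.1 (§3.3; arXiv v1 Prop. 2.2.1), first display, S' = ∅]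
[cite: SkinnerUrban2014, Lemma 3.6 (the paper's pointer for the Shapiro step)] -/
def prop331_nonempty_linearEquiv_prod : Prop :=
  ∀ (W : WeierstrassCurve ℚ) [W.IsElliptic] [W.IsGloballyMinimal] (p : ℕ) [Fact p.Prime],
    p ≠ 2 → IsOrdinaryAt W p →
    ∀ (K : Type) [Field K] [NumberField K], IsImaginaryQuadratic K →
      SatisfiesHeegnerHypothesis (W.conductorNorm ℤ) K →
      ((Ideal.span {(p : ℤ)}).primesOver (𝓞 K)).ncard = 2 →
    ∀ (W' : WeierstrassCurve ℚ) [W'.IsElliptic] [W'.IsGloballyMinimal],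
      (∃ C : VariableChange ℚ, C • W' = W.quadraticTwist (discr K : ℚ)) →
    ∀ (κK : ZpExtension K p) (γK : Field.absoluteGaloisGroup K)
      (κ : ZpExtension ℚ p) (γ : Field.absoluteGaloisGroup ℚ),
      κK.IsCyclotomic → κK.IsTopGenerator γK →
      (∃ ζ : ℤ_[p]ˣ, IsOfFinOrder ζ ∧
        ((GaloisRep.cyclotomicCharacter K p γK * ζ : ℤ_[p]ˣ) : ℤ_[p]) =
          (cyclotomicGenerator p : ℤ_[p])) →
      κ.IsCyclotomic → κ.IsTopGenerator γ → IsCyclotomicVariable p γ →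
    ∀ (DK : (W.baseChange K).SelmerDualData κK γK) (D : W.SelmerDualData κ γ)
      (D' : W'.SelmerDualData κ γ),
      Nonempty (DK.X ≃ₗ[IwasawaAlgebra p] (D.X × D'.X))

end Literature.NumberTheory.EllipticCurves.CastellaGrossiSkinner2025

end
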